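import Mathlib
import Summits.Ventures.LatticeQCDFlow.Scaling.U1CubeMoment

/-!
# LatticeQCDFlow / Scaling — `U(1)` on the torus: the moments of the two stacked plaquette cosines
# against powers of the total cosine of all other plaquettes (atomic inputs of (LC) at `t = 1`)

HONEST FRAMING: exact (Metropolis-corrected) sampling algorithms for lattice gauge theory;
figures of merit are autocorrelation/cost numbers at stated couplings and volumes; no
continuum-physics claim.

Venture `LatticeQCDFlow` (cell pub-lqcd), topic `Scaling`, FANOUT row 30 (lean-1) — OUR WORK, the
lattice half of the leading-coefficient identity (LC) of theory2 item 120
(HOME/lean/theory2/LANDING.md §32), part 3.  `rest i j a` = the genuine plaquettes other than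
`top`, `bot`; `Crest = ∑_{q ∈ rest} c_q`; `X = c_top`, `Y = c_bot`; torus side `L ≥ 3`, `i < j`,
`a ∉ {i, j}`.  In the shapes consumed by `Tilted.cov_jetEq_of_atomic`:
* `integral_XYpow_Crest_one` — `E[XᵅYᵝ C'] = 0`;
* `integral_XYpow_Crest_sq` — `E[XᵅYᵝ C'²] = (#rest/2) m_α m_β`;
* `integral_X_Ypow_Crest_cube`, `integral_Xpow_Y_Crest_cube` — `E[X Yᵝ C'³] = E[XᵅY C'³] = 0`;
The fourth moment `E[XY C'⁴] = 3/4` (the cube term) is the sequel `Scaling/U1CubeSum.lean`.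
Elementary; nothing is cited as a fact; two `def`s (`rest`, `Crest`), no `sorry`.
-/

noncomputable section

open MeasureTheory Filter Topology Finset
open Literature.MathematicalPhysics.QuantumFieldTheory
open Summit.Ventures.LatticeQCDFlow.Theory2.Lattice.TorusGeom

namespace Summit.Ventures.LatticeQCDFlow.Theory2.Lattice.U1Torus

variable {d L : ℕ}

/-- `(∑ f)³` as a triple sum. [folklore] -/
theorem sum_pow_three {ι : Type*} (s : Finset ι) (f : ι → ℝ) :
    (∑ i ∈ s, f i) ^ 3 = ∑ i ∈ s, ∑ j ∈ s, ∑ k ∈ s, f i * f j * f k := by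
  rw [pow_succ, sq, Finset.sum_mul_sum, Finset.sum_mul]
  refine Finset.sum_congr rfl fun i _ => ?_
  rw [Finset.sum_mul]
  refine Finset.sum_congr rfl fun j _ => ?_
  rw [Finset.mul_sum]

/-! ## §1. The other plaquettes and their total cosine -/

/-- The genuine plaquettes other than `top i j` and `bot i j a`. [folklore] -/
def rest (L : ℕ) [NeZero L] (i j a : Fin d) : Finset (TPlaq d L) :=
  ((torusGenuine d L).erase (top i j)).erase (bot i j a)

/-- Membership in `rest`. [folklore] -/
theorem mem_rest [NeZero L] {i j a : Fin d} {q : TPlaq d L} :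
    q ∈ rest L i j a ↔ q.2.1 < q.2.2 ∧ q ≠ top i j ∧ q ≠ bot i j a := by
  simp only [rest, Finset.mem_erase, mem_torusGenuine]
  tauto

/-- The total cosine of the other plaquettes. [folklore] -/
def Crest (L : ℕ) [NeZero L] (i j a : Fin d) (U : ZdGaugeConfig d Circle) : ℝ := ∑ q ∈ rest L i j a, cosT L q U

/-- `Crest` is continuous. [folklore] -/
theorem continuous_Crest [NeZero L] (i j a : Fin d) : Continuous (Crest (d := d) L i j a) := by
  unfold Crest
  exact continuous_finsetSum _ fun q _ => continuous_cosT L q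

/-- `|Crest| ≤ #rest`. [folklore] -/
theorem abs_Crest_le [NeZero L] (i j a : Fin d) (U : ZdGaugeConfig d Circle) :
    |Crest L i j a U| ≤ (rest L i j a).card := by
  unfold Crest
  refine (Finset.abs_sum_le_sum_abs _ _).trans ?_
  calc ∑ q ∈ rest L i j a, |cosT L q U| ≤ ∑ _q ∈ rest L i j a, (1 : ℝ) :=
        Finset.sum_le_sum fun q _ => abs_cosT_le_one L q U
    _ = (rest L i j a).card := by simp

section Sums

variable [NeZero L] {i j a : Fin d}

/-- Integrability of continuous weights (compact configuration space, probability measure). [folklore] -/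
theorem integrable_of_continuous' {F : ZdGaugeConfig d Circle → ℝ} (hF : Continuous F) {K : ℝ}
    (hK : ∀ U, ‖F U‖ ≤ K) : Integrable F (zdHaar d Circle) :=
  Integrable.of_bound hF.measurable.aestronglyMeasurable K (Eventually.of_forall hK)

/-! ## §2. One, two and three other plaquettes -/

/-- **`E[XᵅYᵝ C'] = 0`.** [folklore] -/
theorem integral_XYpow_Crest_one (hL : 3 ≤ L) (hij : i < j) (α β : ℕ) :
    ∫ U, cosT L (top i j) U ^ α * cosT L (bot i j a) U ^ β * Crest L i j a U ^ 1
      ∂(zdHaar d Circle) = 0 := by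
  simp only [pow_one, Crest, Finset.mul_sum]
  rw [integral_finsetSum _ fun q _ => ?_]
  · refine Finset.sum_eq_zero fun q hq => ?_
    obtain ⟨hg, hT, hB⟩ := mem_rest.1 hq
    exact integral_XY_pow_mul_cosT hL hij α β hg hT hB
  · exact integrable_of_continuous' ((continuous_XYpow α β).mul (continuous_cosT L q)) (K := 1)
      fun U => by
        rw [norm_mul]; exact mul_le_one₀ (norm_XYpow_le α β U) (norm_nonneg _)
          (by rw [Real.norm_eq_abs]; exact abs_cosT_le_one L q U)

/-- **`E[XᵅYᵝ C'²] = (#rest / 2) · m_α m_β`.** [folklore] -/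
theorem integral_XYpow_Crest_sq (hL : 3 ≤ L) (hij : i < j) (hai : a ≠ i) (haj : a ≠ j) (α β : ℕ) :
    ∫ U, cosT L (top i j) U ^ α * cosT L (bot i j a) U ^ β * Crest L i j a U ^ 2
      ∂(zdHaar d Circle) =
      ((rest L i j a).card : ℝ) / 2 * ((∫ z, ((z : ℂ).re) ^ α ∂(haarProbability Circle)) *
        ∫ z, ((z : ℂ).re) ^ β ∂(haarProbability Circle)) := by
  set G : ZdGaugeConfig d Circle → ℝ := fun U => cosT L (top i j) U ^ α * cosT L (bot i j a) U ^ β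
    with hG
  have hGc : Continuous G := continuous_XYpow α β
  have hint : ∀ q r : TPlaq d L, Integrable (fun U => G U * (cosT L q U * cosT L r U))
      (zdHaar d Circle) := fun q r =>
    integrable_of_continuous' (hGc.mul ((continuous_cosT L q).mul (continuous_cosT L r))) (K := 1)
      fun U => by
        rw [norm_mul]
        exact mul_le_one₀ (norm_XYpow_le α β U) (norm_nonneg _) (by
          rw [norm_mul]
          exact mul_le_one₀ (by rw [Real.norm_eq_abs]; exact abs_cosT_le_one L q U) (norm_nonneg _)
            (by rw [Real.norm_eq_abs]; exact abs_cosT_le_one L r U))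
  have hexp : ∀ U, G U * Crest L i j a U ^ 2 =
      ∑ q ∈ rest L i j a, ∑ r ∈ rest L i j a, G U * (cosT L q U * cosT L r U) := by
    intro U
    rw [sq, Crest, Finset.sum_mul_sum, Finset.mul_sum]
    refine Finset.sum_congr rfl fun q _ => ?_
    rw [Finset.mul_sum]
  simp_rw [show ∀ U, cosT L (top i j) U ^ α * cosT L (bot i j a) U ^ β = G U from fun U => rfl, hexp]
  rw [integral_finsetSum _ fun q _ => integrable_finsetSum _ fun r _ => hint q r]
  have hdiag : ∀ q ∈ rest L i j a, ∫ U, ∑ r ∈ rest L i j a, G U * (cosT L q U * cosT L r U)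
      ∂(zdHaar d Circle) = (∫ z, ((z : ℂ).re) ^ α ∂(haarProbability Circle)) *
        (∫ z, ((z : ℂ).re) ^ β ∂(haarProbability Circle)) / 2 := by
    intro q hq
    obtain ⟨hg, hT, hB⟩ := mem_rest.1 hq
    rw [integral_finsetSum _ fun r _ => hint q r, Finset.sum_eq_single_of_mem q hq]
    · have : (fun U => G U * (cosT L q U * cosT L q U)) = fun U => G U * cosT L q U ^ 2 := by
        funext U; ring
      rw [this]
      exact integral_XY_pow_mul_cosT_sq hL hij hai haj α β hg hT hB
    · intro r hr hrq
      obtain ⟨hrg, hrT, hrB⟩ := mem_rest.1 hr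
      have : (fun U => G U * (cosT L q U * cosT L r U)) =
          fun U => G U * cosT L q U * cosT L r U := by funext U; ring
      rw [this]
      exact integral_XY_pow_mul_cosT_mul_cosT hL hij α β hrg hg hrT hrB hrq
  rw [Finset.sum_congr rfl hdiag, Finset.sum_const, nsmul_eq_mul]
  ring

/-- **`E[X Yᵝ C'³] = 0`** (three other plaquettes never cover the four bonds of `top`). [folklore] -/
theorem integral_X_Ypow_Crest_cube (hL : 3 ≤ L) (hij : i < j) (hai : a ≠ i) (haj : a ≠ j) (β : ℕ) :
    ∫ U, cosT L (top i j) U ^ 1 * cosT L (bot i j a) U ^ β * Crest L i j a U ^ 3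
      ∂(zdHaar d Circle) = 0 := by
  have hint : ∀ q r s : TPlaq d L, Integrable (fun U => cosT L (bot i j a) U ^ β * cosT L q U *
      cosT L r U * cosT L s U * cosT L (top i j) U) (zdHaar d Circle) := fun q r s =>
    integrable_of_continuous' ((((((continuous_cosT L _).pow β).mul (continuous_cosT L q)).mul
      (continuous_cosT L r)).mul (continuous_cosT L s)).mul (continuous_cosT L _)) (K := 1)
      fun U => by
        rw [norm_mul]
        exact mul_le_one₀ (norm_pow_mul_three_le _ q r s β U) (norm_nonneg _)
          (by rw [Real.norm_eq_abs]; exact abs_cosT_le_one L _ U)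
  have hexp : ∀ U, cosT L (top i j) U ^ 1 * cosT L (bot i j a) U ^ β * Crest L i j a U ^ 3 =
      ∑ q ∈ rest L i j a, ∑ r ∈ rest L i j a, ∑ s ∈ rest L i j a,
        cosT L (bot i j a) U ^ β * cosT L q U * cosT L r U * cosT L s U * cosT L (top i j) U := by
    intro U
    rw [pow_one, Crest, sum_pow_three, Finset.mul_sum]
    refine Finset.sum_congr rfl fun q _ => ?_
    rw [Finset.mul_sum]
    refine Finset.sum_congr rfl fun r _ => ?_
    rw [Finset.mul_sum]
    refine Finset.sum_congr rfl fun s _ => ?_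
    ring
  simp_rw [hexp]
  rw [integral_finsetSum _ fun q _ => integrable_finsetSum _ fun r _ =>
    integrable_finsetSum _ fun s _ => hint q r s]
  refine Finset.sum_eq_zero fun q hq => ?_
  rw [integral_finsetSum _ fun r _ => integrable_finsetSum _ fun s _ => hint q r s]
  refine Finset.sum_eq_zero fun r hr => ?_
  rw [integral_finsetSum _ fun s _ => hint q r s]
  refine Finset.sum_eq_zero fun s hs => ?_
  obtain ⟨hqg, hqT, -⟩ := mem_rest.1 hq
  obtain ⟨hrg, hrT, -⟩ := mem_rest.1 hr
  obtain ⟨hsg, hsT, -⟩ := mem_rest.1 hs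
  exact integral_three_mul_X hL hij hai haj β hqg hrg hsg hqT hrT hsT

/-- **`E[Xᵅ Y C'³] = 0`** (three other plaquettes never cover the four bonds of `bot`). [folklore] -/
theorem integral_Xpow_Y_Crest_cube (hL : 3 ≤ L) (hij : i < j) (hai : a ≠ i) (haj : a ≠ j) (α : ℕ) :
    ∫ U, cosT L (top i j) U ^ α * cosT L (bot i j a) U ^ 1 * Crest L i j a U ^ 3
      ∂(zdHaar d Circle) = 0 := by
  have hint : ∀ q r s : TPlaq d L, Integrable (fun U => cosT L (top i j) U ^ α * cosT L q U *
      cosT L r U * cosT L s U * cosT L (bot i j a) U) (zdHaar d Circle) := fun q r s =>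
    integrable_of_continuous' ((((((continuous_cosT L _).pow α).mul (continuous_cosT L q)).mul
      (continuous_cosT L r)).mul (continuous_cosT L s)).mul (continuous_cosT L _)) (K := 1)
      fun U => by
        rw [norm_mul]
        exact mul_le_one₀ (norm_pow_mul_three_le _ q r s α U) (norm_nonneg _)
          (by rw [Real.norm_eq_abs]; exact abs_cosT_le_one L _ U)
  have hexp : ∀ U, cosT L (top i j) U ^ α * cosT L (bot i j a) U ^ 1 * Crest L i j a U ^ 3 =
      ∑ q ∈ rest L i j a, ∑ r ∈ rest L i j a, ∑ s ∈ rest L i j a,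
        cosT L (top i j) U ^ α * cosT L q U * cosT L r U * cosT L s U * cosT L (bot i j a) U := by
    intro U
    rw [pow_one, Crest, sum_pow_three, Finset.mul_sum]
    refine Finset.sum_congr rfl fun q _ => ?_
    rw [Finset.mul_sum]
    refine Finset.sum_congr rfl fun r _ => ?_
    rw [Finset.mul_sum]
    refine Finset.sum_congr rfl fun s _ => ?_
    ring
  simp_rw [hexp]
  rw [integral_finsetSum _ fun q _ => integrable_finsetSum _ fun r _ =>
    integrable_finsetSum _ fun s _ => hint q r s]
  refine Finset.sum_eq_zero fun q hq => ?_
  rw [integral_finsetSum _ fun r _ => integrable_finsetSum _ fun s _ => hint q r s]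
  refine Finset.sum_eq_zero fun r hr => ?_
  rw [integral_finsetSum _ fun s _ => hint q r s]
  refine Finset.sum_eq_zero fun s hs => ?_
  obtain ⟨hqg, -, hqB⟩ := mem_rest.1 hq
  obtain ⟨hrg, -, hrB⟩ := mem_rest.1 hr
  obtain ⟨hsg, -, hsB⟩ := mem_rest.1 hs
  exact integral_three_mul_Y hL hij hai haj α hqg hrg hsg hqB hrB hsB

end Sums

end Summit.Ventures.LatticeQCDFlow.Theory2.Lattice.U1Torus

end
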